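import Summits.AtomisticToContinuum.HydrodynamicLimit.Theses.AntiMazurCoboundaries
import Literature.Analysis.UnboundedOperators.LinearizedBoltzmannBoundedInverse

/-!
# The weak `L²(γ)` Chapman–Enskog corrector (stub `stub_corrector`, S3)

Stub `stub_corrector` of the line `two-level-corrector-ring-defect` of the crux
`AntiMazurCoboundaries.BoltzmannGreenKubo` (stmt-AtomisticToContinuum-13985).

For a measurable `f ∈ L²(γ)` (`γ = stdGaussian V3`) which is `γ`-orthogonal to the collision
invariants `span(1, v, |v|²)` we produce a measurable `w ∈ L²(γ)`, again orthogonal to the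
collision invariants, solving `L w = -f` **weakly** against the temperate-growth core of the
linearised hard-sphere operator `L = hardSphereLinearizedOp`,
`∫ (L u) w dγ = -∫ u f dγ` for every `u` of temperate growth, and with the variational value
`∫ f w dγ = dirichletFormInv L f`.

Proof. Let `A = -ν + K` be the self-adjoint realisation of `L` on `L²(γ)`
(`linearizedHardSpherePMap`). The tree's bounded inverse on the orthogonal complement of the null
space (`exists_gap_and_inverse_linearizedHardSpherePMap`, Lax–Milgram from the proved spectral gap)
gives `W ∈ dom A`, orthogonal to the invariants, with `A W = [-f] = -[f]`; `w` is the (strongly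
measurable) representative of the class `W`.
* weak equation: for `u` temperate, `A [u] = L u` a.e. (`coeFn_linearizedHardSpherePMap_of_ae_eq`),
  so `∫ (L u) w = ⟪A [u], W⟫ = ⟪[u], A W⟫ = -⟪[u], [f]⟫ = -∫ u f` (symmetry of `A`);
* value: completing the square with `A W = -[f]` and the symmetry of `A`,
  `2⟪[f], x⟫ + ⟪x, A x⟫ = ⟪[f], W⟫ + ⟪x - W, A (x - W)⟫` for `x ∈ dom A`; the last term is `≤ 0`
  (`inner_linearizedHardSpherePMap_self_nonpos`) and of modulus `≤ ‖x - W‖ ‖A x - A W‖`, which is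
  small along the graph-norm Schwartz approximations of `W` (`exists_schwartz_graph_approx`).
  Since the variational family of `dirichletFormInv` at a temperate `g` is `2⟪[f], [g]⟫ + ⟪[g], A [g]⟫`,
  its supremum is `⟪[f], W⟫ = ∫ f w dγ`.

No definitions (pure-proof file). prover-line-stmt-AtomisticToContinuum-13985-0 (stub worker S3).
-/

noncomputable section

namespace Summit.AtomisticToContinuum.HydrodynamicLimit.Theorems

open MeasureTheory ProbabilityTheory Filter Topology Set
open Literature.Analysis.FluidPDE Literature.MathematicalPhysics.KineticTheory
open Literature.Analysis.UnboundedOperators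
open scoped InnerProductSpace ENNReal

namespace BoltzmannGreenKuboCorrector

/-! ### Inner products on `L²(γ)` as integrals -/

/-- The velocity space `V3 = ℝ³` has dimension `3 ≥ 2`. [folklore] -/
theorem two_le_finrank_V3 : 2 ≤ Module.finrank ℝ V3 := by
  rw [finrank_euclideanSpace_fin]; norm_num

/-- The `L²(γ)` inner product of two classes is the integral of the product of their
representatives. [folklore] -/
theorem inner_eq_integral_mul (F G : Lp ℝ 2 (stdGaussian V3)) :
    ⟪F, G⟫_ℝ = ∫ v, (F : V3 → ℝ) v * (G : V3 → ℝ) v ∂(stdGaussian V3) := by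
  rw [L2.inner_def]
  refine integral_congr_ae (Eventually.of_forall fun v => ?_)
  simp only [RCLike.inner_apply, conj_trivial]
  ring

/-- `⟪[f], G⟫ = ∫ f · G dγ` for `f ∈ L²(γ)`. [folklore] -/
theorem inner_toLp_eq_integral_mul {f : V3 → ℝ} (hf : MemLp f 2 (stdGaussian V3))
    (G : Lp ℝ 2 (stdGaussian V3)) :
    ⟪hf.toLp f, G⟫_ℝ = ∫ v, f v * (G : V3 → ℝ) v ∂(stdGaussian V3) := by
  rw [inner_eq_integral_mul]
  refine integral_congr_ae ?_
  filter_upwards [hf.coeFn_toLp] with v hv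
  rw [hv]

/-! ### Completing the square with the self-adjoint realisation `A` -/

/-- Completing the square: if `A W = -F` then, for every `x ∈ dom A`,
`2⟪F, x⟫ + ⟪x, A x⟫ = ⟪F, W⟫ + ⟪x - W, A (x - W)⟫` (symmetry of `A`). [folklore] -/
theorem variational_identity (hE : 2 ≤ Module.finrank ℝ V3)
    (W x : linearizedDomain (E := V3)) (F : Lp ℝ 2 (stdGaussian V3))
    (hAW : linearizedHardSpherePMap hE W = -F) :
    2 * ⟪F, (x : Lp ℝ 2 (stdGaussian V3))⟫_ℝ +
        ⟪(x : Lp ℝ 2 (stdGaussian V3)), linearizedHardSpherePMap hE x⟫_ℝ =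
      ⟪F, (W : Lp ℝ 2 (stdGaussian V3))⟫_ℝ +
        ⟪((x - W : linearizedDomain (E := V3)) : Lp ℝ 2 (stdGaussian V3)),
          linearizedHardSpherePMap hE (x - W)⟫_ℝ := by
  have hsymm : ⟪(W : Lp ℝ 2 (stdGaussian V3)), linearizedHardSpherePMap hE x⟫_ℝ =
      -⟪F, (x : Lp ℝ 2 (stdGaussian V3))⟫_ℝ := by
    rw [← inner_linearizedHardSpherePMap_comm, hAW, inner_neg_left]
  have hsub : linearizedHardSpherePMap hE (x - W) =
      linearizedHardSpherePMap hE x - linearizedHardSpherePMap hE W := LinearPMap.map_sub _ _ _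
  rw [hsub, hAW, Submodule.coe_sub, inner_sub_left, inner_sub_right,
    inner_sub_right, hsymm, inner_neg_right, inner_neg_right,
    real_inner_comm F (x : Lp ℝ 2 (stdGaussian V3)),
    real_inner_comm F (W : Lp ℝ 2 (stdGaussian V3))]
  ring

/-- Upper bound of the variational family: `2⟪F, x⟫ + ⟪x, A x⟫ ≤ ⟪F, W⟫` whenever `A W = -F`
(`A` is non-positive). [folklore] -/
theorem variational_le (hE : 2 ≤ Module.finrank ℝ V3)
    (W x : linearizedDomain (E := V3)) (F : Lp ℝ 2 (stdGaussian V3))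
    (hAW : linearizedHardSpherePMap hE W = -F) :
    2 * ⟪F, (x : Lp ℝ 2 (stdGaussian V3))⟫_ℝ +
        ⟪(x : Lp ℝ 2 (stdGaussian V3)), linearizedHardSpherePMap hE x⟫_ℝ ≤
      ⟪F, (W : Lp ℝ 2 (stdGaussian V3))⟫_ℝ := by
  rw [variational_identity hE W x F hAW]
  have h := inner_linearizedHardSpherePMap_self_nonpos hE (x - W)
  linarith

/-- Lower bound of the variational family: `⟪F, W⟫ - ‖x - W‖ ‖A x - A W‖ ≤ 2⟪F, x⟫ + ⟪x, A x⟫`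
whenever `A W = -F` (Cauchy–Schwarz). [folklore] -/
theorem variational_ge (hE : 2 ≤ Module.finrank ℝ V3)
    (W x : linearizedDomain (E := V3)) (F : Lp ℝ 2 (stdGaussian V3))
    (hAW : linearizedHardSpherePMap hE W = -F) :
    ⟪F, (W : Lp ℝ 2 (stdGaussian V3))⟫_ℝ -
        ‖(x : Lp ℝ 2 (stdGaussian V3)) - W‖ *
          ‖linearizedHardSpherePMap hE x - linearizedHardSpherePMap hE W‖ ≤
      2 * ⟪F, (x : Lp ℝ 2 (stdGaussian V3))⟫_ℝ +
        ⟪(x : Lp ℝ 2 (stdGaussian V3)), linearizedHardSpherePMap hE x⟫_ℝ := by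
  have hsub : linearizedHardSpherePMap hE (x - W) =
      linearizedHardSpherePMap hE x - linearizedHardSpherePMap hE W := LinearPMap.map_sub _ _ _
  rw [variational_identity hE W x F hAW, hsub, Submodule.coe_sub]
  have h := abs_real_inner_le_norm ((x : Lp ℝ 2 (stdGaussian V3)) - W)
    (linearizedHardSpherePMap hE x - linearizedHardSpherePMap hE W)
  have h2 := neg_abs_le ⟪(x : Lp ℝ 2 (stdGaussian V3)) - W,
    linearizedHardSpherePMap hE x - linearizedHardSpherePMap hE W⟫_ℝ
  linarith

/-! ### The variational family at function level -/

/-- The variational functional of `dirichletFormInv` at a temperate `g`, read through the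
self-adjoint realisation: `2⟪f, g⟫_γ + ⟪g, L g⟫_γ = 2⟪[f], x⟫ + ⟪x, A x⟫` for any `x ∈ dom A`
representing `g`. [folklore] -/
theorem dirichlet_term_eq (hE : 2 ≤ Module.finrank ℝ V3) {f g : V3 → ℝ}
    (hf : MemLp f 2 (stdGaussian V3)) (hg : g.HasTemperateGrowth)
    (x : linearizedDomain (E := V3))
    (hx : ((x : Lp ℝ 2 (stdGaussian V3)) : V3 → ℝ) =ᵐ[stdGaussian V3] g) :
    2 * maxwellianInner f g + maxwellianInner g (hardSphereLinearizedOp g) =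
      2 * ⟪hf.toLp f, (x : Lp ℝ 2 (stdGaussian V3))⟫_ℝ +
        ⟪(x : Lp ℝ 2 (stdGaussian V3)), linearizedHardSpherePMap hE x⟫_ℝ := by
  have hA := coeFn_linearizedHardSpherePMap_of_ae_eq hE x hg hx
  have h1 : maxwellianInner f g = ⟪hf.toLp f, (x : Lp ℝ 2 (stdGaussian V3))⟫_ℝ := by
    rw [inner_toLp_eq_integral_mul, maxwellianInner]
    refine integral_congr_ae ?_
    filter_upwards [hx] with v hv
    rw [hv]
  have h2 : maxwellianInner g (hardSphereLinearizedOp g) =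
      ⟪(x : Lp ℝ 2 (stdGaussian V3)), linearizedHardSpherePMap hE x⟫_ℝ := by
    rw [inner_eq_integral_mul, maxwellianInner]
    refine integral_congr_ae ?_
    filter_upwards [hx, hA] with v hv hAv
    rw [hv, hAv]
  rw [h1, h2]

/-- **The variational value.** If `W ∈ dom A` solves `A W = -[f]`, then
`dirichletFormInv L f = sup_g (2⟪f, g⟫_γ + ⟪g, L g⟫_γ) = ⟪[f], W⟫`: every term of the family is
`≤ ⟪[f], W⟫` (completing the square), with equality in the limit along graph-norm Schwartz
approximations of `W`. [folklore] -/
theorem dirichletFormInv_eq_inner (hE : 2 ≤ Module.finrank ℝ V3) {f : V3 → ℝ}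
    (hf : MemLp f 2 (stdGaussian V3)) (W : linearizedDomain (E := V3))
    (hAW : linearizedHardSpherePMap hE W = -hf.toLp f) :
    dirichletFormInv (hardSphereLinearizedOp (E := V3)) f =
      ⟪hf.toLp f, (W : Lp ℝ 2 (stdGaussian V3))⟫_ℝ := by
  unfold dirichletFormInv
  have hle : ∀ g : temperateGrowth V3,
      2 * maxwellianInner f (g : V3 → ℝ) +
          maxwellianInner (g : V3 → ℝ) (hardSphereLinearizedOp (g : V3 → ℝ)) ≤
        ⟪hf.toLp f, (W : Lp ℝ 2 (stdGaussian V3))⟫_ℝ := fun g =>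
    (dirichlet_term_eq hE hf g.2
      ⟨(memLp_two_of_hasTemperateGrowth g.2).toLp _,
        temperateSubmodule_le_linearizedDomain (toLp_mem_temperateSubmodule g.2)⟩
      (memLp_two_of_hasTemperateGrowth g.2).coeFn_toLp).trans_le (variational_le hE W _ _ hAW)
  have hbdd : BddAbove (Set.range fun g : temperateGrowth V3 =>
      2 * maxwellianInner f (g : V3 → ℝ) +
        maxwellianInner (g : V3 → ℝ) (hardSphereLinearizedOp (g : V3 → ℝ))) :=
    ⟨_, by rintro _ ⟨g, rfl⟩; exact hle g⟩
  refine le_antisymm (ciSup_le hle) (le_of_forall_pos_lt_add fun ε hε => ?_)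
  obtain ⟨δ, hδ, hδε⟩ : ∃ δ : ℝ, 0 < δ ∧ δ * δ < ε := by
    refine ⟨min 1 (ε / 2), lt_min one_pos (half_pos hε), ?_⟩
    calc min 1 (ε / 2) * min 1 (ε / 2) ≤ 1 * (ε / 2) :=
          mul_le_mul (min_le_left _ _) (min_le_right _ _) (le_min zero_le_one (half_pos hε).le)
            zero_le_one
      _ < ε := by linarith
  obtain ⟨s, hs1, hs2⟩ := exists_schwartz_graph_approx hE W hδ
  -- the Schwartz class `[s] ∈ dom A`, `δ`-close to `W` in graph norm
  obtain ⟨x, hxs, hx1, hx2⟩ : ∃ x : linearizedDomain (E := V3),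
      ((x : Lp ℝ 2 (stdGaussian V3)) : V3 → ℝ) =ᵐ[stdGaussian V3] s ∧
        ‖(x : Lp ℝ 2 (stdGaussian V3)) - W‖ < δ ∧
        ‖linearizedHardSpherePMap hE x - linearizedHardSpherePMap hE W‖ < δ :=
    ⟨⟨s.toLp 2 (stdGaussian V3), schwartz_toLp_mem_linearizedDomain s⟩,
      s.coeFn_toLp 2 (stdGaussian V3), hs1, hs2⟩
  have hJ := dirichlet_term_eq hE hf s.hasTemperateGrowth x hxs
  have hge := variational_ge hE W x (hf.toLp f) hAW
  have hprod : ‖(x : Lp ℝ 2 (stdGaussian V3)) - W‖ *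
      ‖linearizedHardSpherePMap hE x - linearizedHardSpherePMap hE W‖ < ε :=
    calc _ ≤ δ * δ := mul_le_mul hx1.le hx2.le (norm_nonneg _) hδ.le
      _ < ε := hδε
  calc ⟪hf.toLp f, (W : Lp ℝ 2 (stdGaussian V3))⟫_ℝ
      < 2 * maxwellianInner f s + maxwellianInner s (hardSphereLinearizedOp s) + ε := by
        rw [hJ]; linarith
    _ ≤ (⨆ g : temperateGrowth V3, (2 * maxwellianInner f (g : V3 → ℝ) +
          maxwellianInner (g : V3 → ℝ) (hardSphereLinearizedOp (g : V3 → ℝ)))) + ε :=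
        add_le_add (le_ciSup_of_le hbdd ⟨s, s.hasTemperateGrowth⟩ le_rfl) le_rfl

/-! ### The stub -/

/-- **Stub `stub_corrector` (S3): the weak `L²(γ)` Chapman–Enskog corrector.** For a measurable
`f ∈ L²(γ)` orthogonal to the collision invariants `span(1, v, |v|²)` there is a measurable
`w ∈ L²(γ)`, orthogonal to the collision invariants, solving `L w = -f` weakly against the
temperate-growth core (`∫ (L u) w dγ = -∫ u f dγ`) and with `∫ f w dγ = dirichletFormInv L f`.
Existence: the bounded inverse of the self-adjoint realisation `A = -ν + K` on the orthogonal
complement of its null space (`exists_gap_and_inverse_linearizedHardSpherePMap`, Lax–Milgram from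
the proved spectral gap); weak equation by the symmetry of `A`; value by completing the square
(`dirichletFormInv_eq_inner`). -/
theorem stub_corrector :
    ∀ f : V3 → ℝ, Measurable f → MemLp f 2 (stdGaussian V3) →
      (∀ (c₀ c₂ : ℝ) (b : V3), ∫ v, f v * (c₀ + ⟪b, v⟫_ℝ + c₂ * ‖v‖ ^ 2) ∂(stdGaussian V3) = 0) →
    ∃ w : V3 → ℝ, Measurable w ∧ MemLp w 2 (stdGaussian V3) ∧
      (∀ (c₀ c₂ : ℝ) (b : V3), ∫ v, w v * (c₀ + ⟪b, v⟫_ℝ + c₂ * ‖v‖ ^ 2) ∂(stdGaussian V3) = 0) ∧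
      (∀ u : V3 → ℝ, u ∈ temperateGrowth V3 →
        ∫ v, hardSphereLinearizedOp (E := V3) u v * w v ∂(stdGaussian V3) =
          -∫ v, u v * f v ∂(stdGaussian V3)) ∧
      ∫ v, f v * w v ∂(stdGaussian V3) = dirichletFormInv (hardSphereLinearizedOp (E := V3)) f := by
  intro f _ hf horth
  have hE := two_le_finrank_V3
  -- `-f` is `γ`-orthogonal to the collision invariants
  have hg : MemLp (fun v => -f v) 2 (stdGaussian V3) := hf.neg
  have horth' : ∀ φ ∈ collisionInvariants V3, maxwellianInner (fun v => -f v) φ = 0 := by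
    intro φ hφ
    obtain ⟨a, c, b, rfl⟩ := mem_collisionInvariants_iff.1 hφ
    simp only [maxwellianInner, neg_mul, integral_neg, horth a c b, neg_zero]
  -- the solution `W ∈ dom A` of `A W = [-f]`, orthogonal to the invariants
  obtain ⟨lam, -, hsolve⟩ := exists_gap_and_inverse_linearizedHardSpherePMap (E := V3) hE
  obtain ⟨W, hAW, hWorth, -⟩ := hsolve _ hg horth'
  have hneg : hg.toLp (fun v => -f v) = -hf.toLp f := MemLp.toLp_neg hf
  rw [hneg] at hAW
  refine ⟨((W : Lp ℝ 2 (stdGaussian V3)) : V3 → ℝ), (Lp.stronglyMeasurable _).measurable,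
    Lp.memLp _, fun c₀ c₂ b => hWorth _ (mem_collisionInvariants_iff.2 ⟨c₀, c₂, b, rfl⟩),
    fun u hu => ?_, ?_⟩
  · -- the weak equation
    have hu' : u.HasTemperateGrowth := hu
    obtain ⟨x, hx⟩ : ∃ x : linearizedDomain (E := V3),
        ((x : Lp ℝ 2 (stdGaussian V3)) : V3 → ℝ) =ᵐ[stdGaussian V3] u :=
      ⟨⟨(memLp_two_of_hasTemperateGrowth hu').toLp u,
        temperateSubmodule_le_linearizedDomain (toLp_mem_temperateSubmodule hu')⟩,
        (memLp_two_of_hasTemperateGrowth hu').coeFn_toLp⟩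
    have hA := coeFn_linearizedHardSpherePMap_of_ae_eq hE x hu' hx
    calc ∫ v, hardSphereLinearizedOp u v * ((W : Lp ℝ 2 (stdGaussian V3)) : V3 → ℝ) v
          ∂(stdGaussian V3)
        = ⟪linearizedHardSpherePMap hE x, (W : Lp ℝ 2 (stdGaussian V3))⟫_ℝ := by
          rw [inner_eq_integral_mul]
          refine integral_congr_ae ?_
          filter_upwards [hA] with v hv
          rw [hv]
      _ = ⟪(x : Lp ℝ 2 (stdGaussian V3)), linearizedHardSpherePMap hE W⟫_ℝ :=
          inner_linearizedHardSpherePMap_comm hE x W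
      _ = -∫ v, u v * f v ∂(stdGaussian V3) := by
          rw [hAW, inner_neg_right, inner_eq_integral_mul]
          congr 1
          refine integral_congr_ae ?_
          filter_upwards [hx, hf.coeFn_toLp] with v hv hfv
          rw [hv, hfv]
  · -- the variational value
    rw [dirichletFormInv_eq_inner hE hf W hAW, inner_toLp_eq_integral_mul]

end BoltzmannGreenKuboCorrector

end Summit.AtomisticToContinuum.HydrodynamicLimit.Theorems
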